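import Mathlib
import HarnessLib
import Summits.NavierStokesRegularity.NavierStokesRegularity.Theorems.PoloidalWindowDoorPoloidalWindowRigidityTimeShear

/-!
# Route `PoloidalWindowDoor`, crux `PoloidalWindowRigidity` (K2, stmt-NavierStokesRegularity-19708) — line «lrc-jet» v4,
# stub `stub_timeHeightShear`, STEP 0: the NORMAL FORM of the stratum (TH) «shear slope a function of (time, height)»

Cell ns-regularity-ideate, seat ns-poloidal-K2-p2 gen 4 (stub-worker under the K2 lead ns-poloidal-K2-p1 g5; file landed
`--supports stmt-NavierStokesRegularity-19708 --as helper`; brief HOME/ns-poloidal-K2-p1/BRIEF-stub_timeHeightShear.md STEP 0).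

The registered stub `stub_timeHeightShear` assumes the shear slope of a poloidal class profile is a function of `(t, x₂)` on
SOME nonempty open space–time set `W`: `∂₂v_b(z) = m(z.1, z.2 2) ∂_b v₂(z)` (`b = 0,1`, `z ∈ W`).  This file propagates that
LOCAL identity to EVERY horizontal plane of EVERY slice, in division-free form (ns-poloidal-K2-p3's `…TimeShear` pattern for
(TV), with the doubled configuration space replaced by «two points AT THE SAME HEIGHT»):

* `planeMinor_eq_zero_of_local` — **the plane minors vanish everywhere**: for all `s < 0`, all `y, y′ ∈ ℝ³` and
  `b, b′ ∈ {0,1}`, `∂₂v_b(s,y) ∂_{b′}v₂(s,y″) = ∂₂v_{b′}(s,y″) ∂_b v₂(s,y)` where `y″ = y′ + (y₂ − y′₂)e₂` is `y′` moved to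
  the height of `y` (the function of `(s,y,y′)` is jointly real-analytic on the connected slab `(−∞,0) × ℝ³ × ℝ³`
  — `…K2OfLrcSlope.analyticOnNhd_uncurry_fderiv_entry` — and vanishes on the nonempty open set
  `{(s,y) ∈ W, (s,y″) ∈ W}`).
* `planeShear_or_flat_of_minor` — pointwise algebra on ONE plane: vanishing minors ⇒ the plane is horizontally flat
  (`∇_h v₂ ≡ 0` on it) or proportional-shear with ONE slope `μ`.
* `timeHeightShear_normalForm` — **THE NORMAL FORM**: class + the local (TH) identity ⇒ for every `s < 0` and every height
  `c`, the plane `{y₂ = c}` of the slice `s` is EITHER horizontally flat OR proportional-shear with one slope `μ(s,c)`: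
  `∂₂v_b(s,y) = μ(s,c) ∂_b v₂(s,y)` for all `y` with `y₂ = c`, `b = 0,1`.  (Flat planes are genuinely exceptional: on
  them the slope may have a pole; if they fill an open set of `(s,c)` the profile vanishes by nsreg-p7's flat germ —
  `eq_zero_of_flatPlanes_open`.)
* `analyticAt_planeSlope` — any choice of the slopes `μ : ℝ → ℝ → ℝ` is JOINTLY real-analytic at every `(s₀,c₀)` whose plane
  carries a point `y₀` with `∂_{b₀}v₂(s₀,y₀) ≠ 0` (near `(s₀,c₀)` it is the ratio of two Jacobian entries along the analytic
  map `(s,c) ↦ (s, y₀ + (c − y₀₂)e₂)`).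

STEP 1 of the brief is the lead's p530500 `…TimeHeightShearPressure` ((TH) pressure law); STEP 2 (the (TV) method in the
variable `Z = √(1−μ)·v₂`, which removes the quadratic source, located obstruction = the linear critical terms) is the seat's
next file.  WHAT THIS IS NOT: not a claim about Navier–Stokes regularity and not the stub — its normal form (bears_on
LADDER-NS N0 via crux K2 = stmt-19708).
-/

noncomputable section

-- the summit and its single sub-problem share the name (CONVENTIONS §1), as in every Theorems file
set_option linter.dupNamespace false

namespace Summit.NavierStokesRegularity.NavierStokesRegularity.Theorems.PoloidalWindowDoorPoloidalWindowRigidityTimeHeightShearNormalForm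

open Set Function Filter Topology Metric
open scoped RealInnerProductSpace InnerProductSpace
open Literature.Analysis Literature.Analysis.FluidPDE
open Summit.NavierStokesRegularity.NavierStokesRegularity.Theorems.LocalSineTubeDoorProfileAlignedWindowRigidityAncient
open Summit.NavierStokesRegularity.NavierStokesRegularity.Theorems.PoloidalWindowDoorPoloidalWindowRigiditySymmetryGerms
open Summit.NavierStokesRegularity.NavierStokesRegularity.Theorems.PoloidalWindowDoorPoloidalWindowRigidityK2OfLrcSlope
open Summit.NavierStokesRegularity.NavierStokesRegularity.Theorems.PoloidalWindowDoorPoloidalWindowRigidityTimeShear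

variable {C : ℝ} {v : ℝ → EuclideanSpace ℝ (Fin 3) → EuclideanSpace ℝ (Fin 3)}

/-! ### Moving a point to a prescribed height: `y′ ↦ y′ + (y₂ − y′₂) e₂` -/

/-- The point `y′ + (y₂ − y′₂)e₂` has the height of `y`. -/
theorem moved_apply_two (y y' : EuclideanSpace ℝ (Fin 3)) :
    (y' + (y 2 - y' 2) • EuclideanSpace.single 2 (1 : ℝ) : EuclideanSpace ℝ (Fin 3)) 2 = y 2 := by
  simp

/-- A point already at the height of `y` is not moved. -/
theorem moved_of_eq {y y' : EuclideanSpace ℝ (Fin 3)} (h : y' 2 = y 2) :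
    y' + (y 2 - y' 2) • EuclideanSpace.single 2 (1 : ℝ) = y' := by
  simp [h]

/-- The move is a continuous affine expression in `(y, y′)`, hence jointly real-analytic. -/
theorem analyticAt_moved (p : EuclideanSpace ℝ (Fin 3) × EuclideanSpace ℝ (Fin 3)) :
    AnalyticAt ℝ (fun q : EuclideanSpace ℝ (Fin 3) × EuclideanSpace ℝ (Fin 3) =>
      q.2 + (q.1 2 - q.2 2) • EuclideanSpace.single 2 (1 : ℝ)) p := by
  have h1 : AnalyticAt ℝ (fun q : EuclideanSpace ℝ (Fin 3) × EuclideanSpace ℝ (Fin 3) => q.1 2) p :=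
    ((EuclideanSpace.proj (𝕜 := ℝ) (2 : Fin 3) : EuclideanSpace ℝ (Fin 3) →L[ℝ] ℝ).analyticAt _).comp analyticAt_fst
  have h2 : AnalyticAt ℝ (fun q : EuclideanSpace ℝ (Fin 3) × EuclideanSpace ℝ (Fin 3) => q.2 2) p :=
    ((EuclideanSpace.proj (𝕜 := ℝ) (2 : Fin 3) : EuclideanSpace ℝ (Fin 3) →L[ℝ] ℝ).analyticAt _).comp analyticAt_snd
  exact analyticAt_snd.add ((h1.sub h2).smul analyticAt_const)

/-- The move is continuous in `(y, y′)`. -/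
theorem continuous_moved :
    Continuous (fun q : EuclideanSpace ℝ (Fin 3) × EuclideanSpace ℝ (Fin 3) =>
      q.2 + (q.1 2 - q.2 2) • EuclideanSpace.single 2 (1 : ℝ)) := by
  fun_prop

/-! ### Propagation of the local (TH) identity to every plane of every slice -/

section Class

variable (hrate : HasTypeITimeDecay C v) (hcont : ContinuousOn (uncurry v) (Iio (0 : ℝ) ×ˢ univ))
  (hmild : ∀ s t : ℝ, s < t → t < 0 → ∀ x,
    v t x = UnboundedOperators.heatExtension (v s) (t - s) x - oseenDuhamel 1 s v v t x)

include hrate hcont hmild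

/-- **THE PLANE MINORS VANISH EVERYWHERE.**  If on a nonempty open subset `W` of the backward slab the shear slope is a
function of time and height, `∂₂v_b(z) = m(z.1, z.2 2) ∂_b v₂(z)` (`b = 0,1`), then for EVERY `s < 0`, all `y, y′ ∈ ℝ³`
and `b, b′ ∈ {0,1}`, with `y″ = y′ + (y₂ − y′₂)e₂` (the point `y′` moved to the height of `y`):
`∂₂v_b(s,y) · ∂_{b′}v₂(s,y″) = ∂₂v_{b′}(s,y″) · ∂_b v₂(s,y)`. -/
theorem planeMinor_eq_zero_of_local
    {W : Set (ℝ × EuclideanSpace ℝ (Fin 3))} (hW : IsOpen W) (hWne : W.Nonempty) (hWs : W ⊆ Iio (0 : ℝ) ×ˢ univ)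
    {m : ℝ → ℝ → ℝ}
    (h : ∀ z ∈ W, ∀ b : Fin 3, b ≠ 2 →
      fderiv ℝ (v z.1) z.2 (EuclideanSpace.single 2 1) b =
        m z.1 (z.2 2) * fderiv ℝ (v z.1) z.2 (EuclideanSpace.single b 1) 2) :
    ∀ s < 0, ∀ (y y' : EuclideanSpace ℝ (Fin 3)) (b b' : Fin 3), b ≠ 2 → b' ≠ 2 →
      fderiv ℝ (v s) y (EuclideanSpace.single 2 1) b * fderiv ℝ (v s) (y' + (y 2 - y' 2) • EuclideanSpace.single 2 (1 : ℝ)) (EuclideanSpace.single b' 1) 2 =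
        fderiv ℝ (v s) (y' + (y 2 - y' 2) • EuclideanSpace.single 2 (1 : ℝ)) (EuclideanSpace.single 2 1) b' *
          fderiv ℝ (v s) y (EuclideanSpace.single b 1) 2 := by
  intro s hs y y' b b' hb hb'
  -- the doubled configuration space `P = (−∞,0) × (ℝ³ × ℝ³)` and the two (analytic) projections to the slab
  set P : Set (ℝ × (EuclideanSpace ℝ (Fin 3) × EuclideanSpace ℝ (Fin 3))) := Iio (0 : ℝ) ×ˢ univ with hP
  set π₁ : ℝ × (EuclideanSpace ℝ (Fin 3) × EuclideanSpace ℝ (Fin 3)) → ℝ × EuclideanSpace ℝ (Fin 3) :=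
    fun z => (z.1, z.2.1) with hπ₁
  set π₂ : ℝ × (EuclideanSpace ℝ (Fin 3) × EuclideanSpace ℝ (Fin 3)) → ℝ × EuclideanSpace ℝ (Fin 3) :=
    fun z => (z.1, z.2.2 + (z.2.1 2 - z.2.2 2) • EuclideanSpace.single 2 (1 : ℝ)) with hπ₂
  have hπ₁a : AnalyticOnNhd ℝ π₁ univ := fun z _ => analyticAt_fst.prod (analyticAt_fst.comp analyticAt_snd)
  have hπ₂a : AnalyticOnNhd ℝ π₂ univ := fun z _ =>
    analyticAt_fst.prod ((analyticAt_moved _).comp analyticAt_snd)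
  have hπ₁c : Continuous π₁ := continuous_fst.prodMk (continuous_fst.comp continuous_snd)
  have hπ₂c : Continuous π₂ := continuous_fst.prodMk (continuous_moved.comp continuous_snd)
  have hπ₁m : MapsTo π₁ P (Iio (0 : ℝ) ×ˢ univ) := fun z hz => mk_mem_prod (mem_prod.1 hz).1 (mem_univ _)
  have hπ₂m : MapsTo π₂ P (Iio (0 : ℝ) ×ˢ univ) := fun z hz => mk_mem_prod (mem_prod.1 hz).1 (mem_univ _)
  -- the four Jacobian entries pulled back to `P`
  have hE : ∀ (j i : Fin 3) (π : ℝ × (EuclideanSpace ℝ (Fin 3) × EuclideanSpace ℝ (Fin 3)) → ℝ × EuclideanSpace ℝ (Fin 3)),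
      AnalyticOnNhd ℝ π univ → MapsTo π P (Iio (0 : ℝ) ×ˢ univ) →
      AnalyticOnNhd ℝ (fun z => fderiv ℝ (v (π z).1) (π z).2 (EuclideanSpace.single j 1) i) P := by
    intro j i π hπ hπm
    exact (analyticOnNhd_uncurry_fderiv_entry hrate hcont hmild j i).comp (hπ.mono (subset_univ P)) hπm
  -- the minor as a jointly analytic function on `P`
  set G : ℝ × (EuclideanSpace ℝ (Fin 3) × EuclideanSpace ℝ (Fin 3)) → ℝ := fun z =>
    fderiv ℝ (v (π₁ z).1) (π₁ z).2 (EuclideanSpace.single 2 1) b *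
        fderiv ℝ (v (π₂ z).1) (π₂ z).2 (EuclideanSpace.single b' 1) 2 -
      fderiv ℝ (v (π₂ z).1) (π₂ z).2 (EuclideanSpace.single 2 1) b' *
        fderiv ℝ (v (π₁ z).1) (π₁ z).2 (EuclideanSpace.single b 1) 2 with hG
  have hGa : AnalyticOnNhd ℝ G P :=
    ((hE 2 b π₁ hπ₁a hπ₁m).mul (hE b' 2 π₂ hπ₂a hπ₂m)).sub ((hE 2 b' π₂ hπ₂a hπ₂m).mul (hE b 2 π₁ hπ₁a hπ₁m))
  -- `G` vanishes on the nonempty open set `π₁⁻¹ W ∩ π₂⁻¹ W` (two points of `W` at the SAME height use the same slope)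
  obtain ⟨z₀, hz₀⟩ := hWne
  set z₁ : ℝ × (EuclideanSpace ℝ (Fin 3) × EuclideanSpace ℝ (Fin 3)) := (z₀.1, (z₀.2, z₀.2)) with hz₁
  have hz₁P : z₁ ∈ P := mk_mem_prod (mem_prod.1 (hWs hz₀)).1 (mem_univ _)
  have hopen : IsOpen (π₁ ⁻¹' W ∩ π₂ ⁻¹' W) := (hW.preimage hπ₁c).inter (hW.preimage hπ₂c)
  have hπ₂z₁ : π₂ z₁ = z₀ := by
    simp [hπ₂, hz₁]
  have hz₁W : z₁ ∈ π₁ ⁻¹' W ∩ π₂ ⁻¹' W := ⟨by simpa [hπ₁, hz₁] using hz₀, by rw [mem_preimage, hπ₂z₁]; exact hz₀⟩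
  have hev : G =ᶠ[𝓝 z₁] 0 := by
    filter_upwards [hopen.mem_nhds hz₁W] with z hz
    obtain ⟨h1, h2⟩ := hz
    show fderiv ℝ (v (π₁ z).1) (π₁ z).2 (EuclideanSpace.single 2 1) b *
        fderiv ℝ (v (π₂ z).1) (π₂ z).2 (EuclideanSpace.single b' 1) 2 -
      fderiv ℝ (v (π₂ z).1) (π₂ z).2 (EuclideanSpace.single 2 1) b' *
        fderiv ℝ (v (π₁ z).1) (π₁ z).2 (EuclideanSpace.single b 1) 2 = 0
    have hh : (π₂ z).2 2 = (π₁ z).2 2 := by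
      simp only [hπ₁, hπ₂]
      exact moved_apply_two _ _
    rw [h (π₁ z) h1 b hb, h (π₂ z) h2 b' hb', hh]
    simp only [hπ₁, hπ₂]
    ring
  have hpre : IsPreconnected P :=
    ((convex_Iio (0 : ℝ)).prod (convex_univ :
      Convex ℝ (univ : Set (EuclideanSpace ℝ (Fin 3) × EuclideanSpace ℝ (Fin 3))))).isPreconnected
  have hzero := hGa.eqOn_zero_of_preconnected_of_eventuallyEq_zero hpre hz₁P hev
  have hmem : ((s, (y, y')) : ℝ × (EuclideanSpace ℝ (Fin 3) × EuclideanSpace ℝ (Fin 3))) ∈ P :=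
    mk_mem_prod hs (mem_univ _)
  have := hzero hmem
  simpa [hG, hπ₁, hπ₂, sub_eq_zero] using this

end Class

/-! ### Vanishing plane minors ⇒ each plane is flat or proportional-shear -/

/-- **Vanishing minors on one plane ⇒ flat or proportional-shear.**  Pointwise algebra on the plane `{y₂ = c}` of a field
`V`: if `∂₂V_b(y) ∂_{b′}V₂(y′) = ∂₂V_{b′}(y′) ∂_b V₂(y)` for all `y, y′` at height `c` (`b, b′ ∈ {0,1}`), then either
`∇_h V₂ ≡ 0` on the plane or there is ONE real `μ` with `∂₂V_b = μ ∂_b V₂` on the plane (`b = 0,1`). -/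
theorem planeShear_or_flat_of_minor {V : EuclideanSpace ℝ (Fin 3) → EuclideanSpace ℝ (Fin 3)} {c : ℝ}
    (h : ∀ (y y' : EuclideanSpace ℝ (Fin 3)), y 2 = c → y' 2 = c → ∀ (b b' : Fin 3), b ≠ 2 → b' ≠ 2 →
      fderiv ℝ V y (EuclideanSpace.single 2 1) b * fderiv ℝ V y' (EuclideanSpace.single b' 1) 2 =
        fderiv ℝ V y' (EuclideanSpace.single 2 1) b' * fderiv ℝ V y (EuclideanSpace.single b 1) 2) :
    (∀ y, y 2 = c → fderiv ℝ V y (EuclideanSpace.single 0 1) 2 = 0 ∧ fderiv ℝ V y (EuclideanSpace.single 1 1) 2 = 0) ∨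
      ∃ μ : ℝ, ∀ y, y 2 = c → ∀ b : Fin 3, b ≠ 2 →
        fderiv ℝ V y (EuclideanSpace.single 2 1) b = μ * fderiv ℝ V y (EuclideanSpace.single b 1) 2 := by
  by_cases hex : ∃ (y' : EuclideanSpace ℝ (Fin 3)) (b' : Fin 3), y' 2 = c ∧ b' ≠ 2 ∧
      fderiv ℝ V y' (EuclideanSpace.single b' 1) 2 ≠ 0
  · obtain ⟨y', b', hy', hb', hne⟩ := hex
    refine Or.inr ⟨fderiv ℝ V y' (EuclideanSpace.single 2 1) b' / fderiv ℝ V y' (EuclideanSpace.single b' 1) 2,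
      fun y hy b hb => ?_⟩
    have key := h y y' hy hy' b b' hb hb'
    rw [div_mul_eq_mul_div, eq_div_iff hne]
    linear_combination key
  · push Not at hex
    exact Or.inl fun y hy => ⟨hex y 0 hy (by decide), hex y 1 hy (by decide)⟩

section Class

variable (hrate : HasTypeITimeDecay C v) (hcont : ContinuousOn (uncurry v) (Iio (0 : ℝ) ×ˢ univ))
  (hmild : ∀ s t : ℝ, s < t → t < 0 → ∀ x,
    v t x = UnboundedOperators.heatExtension (v s) (t - s) x - oseenDuhamel 1 s v v t x)

include hrate hcont hmild

/-- **THE (TH) NORMAL FORM.**  Let `v` be a profile of the route's Type-I class whose shear slope is a function of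
`(time, height)` on some nonempty open space–time subset `W` of the backward slab.  Then for EVERY `s < 0` and EVERY height
`c`, the plane `{y₂ = c}` of the slice `s` is either horizontally flat (`∂₀v₂ = ∂₁v₂ = 0` on it) or proportional-shear
with one slope `μ`: `∂₂v_b(s,y) = μ ∂_b v₂(s,y)` for all `y` with `y₂ = c`, `b = 0,1`. -/
theorem timeHeightShear_normalForm
    {W : Set (ℝ × EuclideanSpace ℝ (Fin 3))} (hW : IsOpen W) (hWne : W.Nonempty) (hWs : W ⊆ Iio (0 : ℝ) ×ˢ univ)
    {m : ℝ → ℝ → ℝ}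
    (h : ∀ z ∈ W, ∀ b : Fin 3, b ≠ 2 →
      fderiv ℝ (v z.1) z.2 (EuclideanSpace.single 2 1) b =
        m z.1 (z.2 2) * fderiv ℝ (v z.1) z.2 (EuclideanSpace.single b 1) 2) :
    ∀ s < 0, ∀ c : ℝ,
      (∀ y : EuclideanSpace ℝ (Fin 3), y 2 = c →
          fderiv ℝ (v s) y (EuclideanSpace.single 0 1) 2 = 0 ∧ fderiv ℝ (v s) y (EuclideanSpace.single 1 1) 2 = 0) ∨
        ∃ μ : ℝ, ∀ y : EuclideanSpace ℝ (Fin 3), y 2 = c → ∀ b : Fin 3, b ≠ 2 →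
          fderiv ℝ (v s) y (EuclideanSpace.single 2 1) b = μ * fderiv ℝ (v s) y (EuclideanSpace.single b 1) 2 := by
  intro s hs c
  have hmin := planeMinor_eq_zero_of_local hrate hcont hmild hW hWne hWs h s hs
  refine planeShear_or_flat_of_minor (V := v s) (c := c) fun y y' hy hy' b b' hb hb' => ?_
  have hm := hmin y y' b b' hb hb'
  have e : y' + (y 2 - y' 2) • EuclideanSpace.single 2 (1 : ℝ) = y' := moved_of_eq (by rw [hy, hy'])
  rwa [e] at hm

/-- **Flat planes filling an open set of `(s, c)` force `v ≡ 0`** (nsreg-p7's flat germ `eq_zero_of_horizontalGradient_eq_zero_on_open`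
on the open set of the slice swept by those planes).  So in the normal form the flat planes of a non-trivial profile are nowhere
dense in `(s, c)`. -/
theorem eq_zero_of_flatPlanes_open (hdiv : ∀ t < 0, VectorCalculus.IsDivFree (v t))
    (hpol : ∀ s < 0, ∀ y, ⟪curl (v s) y, EuclideanSpace.single 2 1⟫_ℝ = 0) {s : ℝ} (hs : s < 0) {I : Set ℝ}
    (hI : IsOpen I) (hIne : I.Nonempty)
    (hflat : ∀ c ∈ I, ∀ y : EuclideanSpace ℝ (Fin 3), y 2 = c →
      fderiv ℝ (v s) y (EuclideanSpace.single 0 1) 2 = 0 ∧ fderiv ℝ (v s) y (EuclideanSpace.single 1 1) 2 = 0) :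
    ∀ t < 0, ∀ x, v t x = 0 := by
  -- the open set of the slice swept by the flat planes
  have hU : IsOpen {y : EuclideanSpace ℝ (Fin 3) | y 2 ∈ I} :=
    hI.preimage (EuclideanSpace.proj (𝕜 := ℝ) (2 : Fin 3)).continuous
  obtain ⟨c₀, hc₀⟩ := hIne
  have hUne : ({y : EuclideanSpace ℝ (Fin 3) | y 2 ∈ I}).Nonempty :=
    ⟨c₀ • EuclideanSpace.single 2 (1 : ℝ), by simpa using hc₀⟩
  exact eq_zero_of_horizontalGradient_eq_zero_on_open hrate hcont hmild hdiv hs (hpol s hs) hU hUne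
    fun y hy => (hflat (y 2) hy y rfl).1

/-- **Joint analyticity of the slope in `(time, height)`.**  Let `μ : ℝ → ℝ → ℝ` be ANY choice of plane slopes
(`∂₂v_b(s,y) = μ(s, y₂) ∂_b v₂(s,y)` for all `s < 0`, `y`, `b = 0,1`).  If the plane `{y₂ = c₀}` of the slice `s₀ < 0`
carries a point `y₀` (`y₀₂ = c₀`) and an index `b₀ ∈ {0,1}` with `∂_{b₀}v₂(s₀,y₀) ≠ 0`, then `uncurry μ` is real-analytic at
`(s₀, c₀)`: near it, `μ(s,c)` is the ratio of two Jacobian entries at the point `y₀ + (c − c₀)e₂` of the plane `c`, and the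
entries are jointly analytic in `(s, y)`. -/
theorem analyticAt_planeSlope {μ : ℝ → ℝ → ℝ}
    (hμ : ∀ s < 0, ∀ y, ∀ b : Fin 3, b ≠ 2 →
      fderiv ℝ (v s) y (EuclideanSpace.single 2 1) b = μ s (y 2) * fderiv ℝ (v s) y (EuclideanSpace.single b 1) 2)
    {s₀ : ℝ} (hs₀ : s₀ < 0) {y₀ : EuclideanSpace ℝ (Fin 3)} {b₀ : Fin 3} (hb₀ : b₀ ≠ 2)
    (hne : fderiv ℝ (v s₀) y₀ (EuclideanSpace.single b₀ 1) 2 ≠ 0) :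
    AnalyticAt ℝ (uncurry μ) (s₀, y₀ 2) := by
  -- the analytic family of points `(s,c) ↦ (s, y₀ + (c − y₀₂) e₂)`, landing in the plane `c` of the slice `s`
  set ι : ℝ × ℝ → ℝ × EuclideanSpace ℝ (Fin 3) :=
    fun p => (p.1, y₀ + (p.2 - y₀ 2) • EuclideanSpace.single 2 (1 : ℝ)) with hι
  have hιa : AnalyticAt ℝ ι (s₀, y₀ 2) := by
    refine analyticAt_fst.prod ?_
    exact analyticAt_const.add ((analyticAt_snd.sub analyticAt_const).smul analyticAt_const)
  have hι₀ : ι (s₀, y₀ 2) = (s₀, y₀) := by simp [hι]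
  have hmem : ι (s₀, y₀ 2) ∈ Iio (0 : ℝ) ×ˢ (univ : Set (EuclideanSpace ℝ (Fin 3))) := by
    rw [hι₀]; exact mk_mem_prod hs₀ (mem_univ _)
  have hheight : ∀ p : ℝ × ℝ, (ι p).2 2 = p.2 := by
    intro p; simp [hι]
  -- the two entries along the family
  have hA : AnalyticAt ℝ (fun p : ℝ × ℝ => fderiv ℝ (v (ι p).1) (ι p).2 (EuclideanSpace.single 2 1) b₀) (s₀, y₀ 2) :=
    (analyticOnNhd_uncurry_fderiv_entry hrate hcont hmild 2 b₀ _ hmem).comp hιa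
  have ha : AnalyticAt ℝ (fun p : ℝ × ℝ => fderiv ℝ (v (ι p).1) (ι p).2 (EuclideanSpace.single b₀ 1) 2) (s₀, y₀ 2) :=
    (analyticOnNhd_uncurry_fderiv_entry hrate hcont hmild b₀ 2 _ hmem).comp hιa
  -- near `(s₀, y₀₂)` the denominator does not vanish, the time is negative, and `μ` is the ratio
  have hne₀ : fderiv ℝ (v (ι (s₀, y₀ 2)).1) (ι (s₀, y₀ 2)).2 (EuclideanSpace.single b₀ 1) 2 ≠ 0 := by
    rw [hι₀]; exact hne
  have hne' : ∀ᶠ p in 𝓝 (s₀, y₀ 2),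
      fderiv ℝ (v (ι p).1) (ι p).2 (EuclideanSpace.single b₀ 1) 2 ≠ 0 := ha.continuousAt.eventually_ne hne₀
  have hneg : ∀ᶠ p : ℝ × ℝ in 𝓝 (s₀, y₀ 2), p.1 < 0 :=
    (continuous_fst.tendsto _).eventually (Iio_mem_nhds hs₀)
  have hev : uncurry μ =ᶠ[𝓝 (s₀, y₀ 2)] fun p =>
      fderiv ℝ (v (ι p).1) (ι p).2 (EuclideanSpace.single 2 1) b₀ /
        fderiv ℝ (v (ι p).1) (ι p).2 (EuclideanSpace.single b₀ 1) 2 := by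
    filter_upwards [hne', hneg] with p hp1 hp2
    have hι1 : (ι p).1 = p.1 := rfl
    rw [hμ (ι p).1 (by rw [hι1]; exact hp2) (ι p).2 b₀ hb₀, hheight p, mul_div_cancel_right₀ _ hp1]
    rcases p with ⟨s, c⟩
    rfl
  exact (hA.div ha hne₀).congr hev.symm

end Class

end Summit.NavierStokesRegularity.NavierStokesRegularity.Theorems.PoloidalWindowDoorPoloidalWindowRigidityTimeHeightShearNormalForm

end
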